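import Summits.BirchSwinnertonDyer.BirchSwinnertonDyer.Theorems.GoldfeldAllTwistsTwoConverseTwinAdditiveInertTwistTwoSelmer
import Literature.NumberTheory.EllipticCurves.TwoIsogenyShaTwoTorsion
import Literature.NumberTheory.EllipticCurves.SelmerTrivialCorankProofs
import Summits.BirchSwinnertonDyer.BirchSwinnertonDyer.Theorems.GoldfeldAllTwistsTwoConverseTwinAdditiveReduction
import HarnessLib

set_option linter.dupNamespace false -- namespace `…BirchSwinnertonDyer.BirchSwinnertonDyer…` is the cell's (D-0017 nested layout)
set_option autoImplicit false

/-!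
# Twin″ (item 19140) on the additive INERT-TWIST family, VII: `rank ≤ 1`, `Ш[2] = 0` in rank one, and
# `BSD(W,2)` as a `2`-adic unit statement, for `49a1^{(−m)}` and `49a1^{(−2m)}`, `m` squarefree with all
# prime factors `≡ 1 (mod 4)` and inert in `ℚ(√−7)`

Cell `bsd-goldfeld`, seat `bsd-goldfeld-s1p-c301` (gen 2); `--supports stmt-BirchSwinnertonDyer-19140`. The
consequences of parts V–VI (the Selmer containments `S(−21m,112m²) ⊆ {1,2,7,14}`, `S(42m,−7m²) ⊆ {1,−7}`,
`S(−42m,448m²) ⊆ {1,2,7,14}`, `S(84m,−28m²) ⊆ {1,−7}` for composite `m`), read through the tree's exact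
descent count `2^{dim S + dim S'} = 2^{rank+2} · #Ш(V₀)[Ξ] · #Ш(E)[Ξ]` (`two_pow_twoIsogenySelmerRank_add_eq`,
Silverman X.4.2(a)) — here in the symmetric form `#S · #S' ≤ 8` (`rank_le_one_and_sha_parts_of_card_mul_le`)
— and `φ̂ ∘ φ = [2]` (`forall_mem_sha_two_smul_eq_zero_of_halfModel`). For `d ∈ {−m, −2m}` and EVERY model
`W/ℚ` of `49a1^{(d)}` (`C • W = cm7.quadraticTwist d`; the two-torsion models are
`E_d = ⟨(mk0 2)⁻¹, 2d, 0, 0⟩ • cm7^{(d)} = ⟨0, 21d, 0, 112d², 0⟩`,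
`smul_eq_twoTorsionModel_of_smul_eq_quadraticTwist`):

* `rank W(ℚ) ≤ 1` UNCONDITIONALLY (`rank_le_one_inertTwist`, `rank_le_one_inertTwoTwist`);
* `rank W(ℚ) = 1 ⇒ Ш(W/ℚ)[2] = 0` (`forall_mem_sha_two_smul_eq_zero_inertTwist`, `…_inertTwoTwist`);
* in analytic rank one, granted GZK (`hGZK : rank_eq_analyticRank_of_analyticRank_le_one`): `rank = 1`,
  `Ш(W)[2^∞] = 0`, `corank_{ℤ₂} Sel_{2^∞}(W) = 1` (the hypothesis of K12₂″, item 20044, holds) and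
  **`BSD(W,2) ⟺ ∃ q : ℚ, #Ш_an(W) = q ∧ ord₂ q = 0`** (`bsdp_two_iff_shaAn_unit_inertTwist`,
  `bsdp_two_iff_shaAn_unit_inertTwoTwist`).

So on the infinite sub-family `𝒟 = {−m, −2m : m ≥ 1 squarefree, ℓ ∣ m ⇒ ℓ ≡ 1 (4) ∧ (−7/ℓ) = −1}` of
the additive cell (containing the base curves `784 = 49a1^{(−1)}`, `3136 = 49a1^{(−2)}`, closed under
multiplying `m` by further such primes; `250` members with `|d| ≤ 3000`, all of analytic rank `1`) twin″
IS the single `2`-adic unit statement for `#Ш_an = L'(E,1)·4/(Ω·Reg·∏c_ℓ)`, with the algebraic side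
(`rank = 1`, `Ш[2^∞] = 0`) SETTLED. Numerically (gen-0 kit tables): all `208` resolved members have
`Ш[2] = 0` and `#Ш_an ∈ {1 (×205), 9 (×3)}`. The prime case `m = ℓ` of the first family is part II
(`…TwinAdditivePrimeTwistDescent.lean`), whose general lemmas are restated here in symmetric form and
otherwise inlined (this file does not import part II). HONEST FRAMING: no `BSD(W,2)` is proved; BSD is
not proved by any of this.

## References

* J. H. Silverman, *The Arithmetic of Elliptic Curves*, 2nd ed. (2009), Thm. X.4.2(a), Prop. X.4.9,
  Thm. III.6.2(a). [SilvermanAEC2009]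
* R. L. Miller, LMS J. Comput. Math. 14 (2011), Def. 1.1. [Miller2011LMS]
* R. Greenberg, *Iwasawa theory for elliptic curves*, LNM 1716 (1999), §1. [Greenberg1999LNM]
-/

noncomputable section

open scoped Classical

open WeierstrassCurve Literature.NumberTheory.EllipticCurves

namespace Summit.BirchSwinnertonDyer.BirchSwinnertonDyer.Theorems.GoldfeldGoodTwists

/-! ## §1. Counting, symmetric form -/

/-- Arithmetic core: `k = 2^{r+2} (n₁ n₂) ≤ 8`, `k > 0` ⇒ `r ≤ 1`, and `n₁ = n₂ = 1` if `r = 1`. [folklore] -/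
private theorem rank_le_one_arith' {r n₁ n₂ k : ℕ} (hk : k = 2 ^ (r + 2) * (n₁ * n₂)) (hk8 : k ≤ 8)
    (hkpos : 0 < k) : r ≤ 1 ∧ (r = 1 → n₁ = 1 ∧ n₂ = 1) := by
  subst hk
  have hn₁ : 0 < n₁ := Nat.pos_of_ne_zero (by rintro rfl; simp at hkpos)
  have hn₂ : 0 < n₂ := Nat.pos_of_ne_zero (by rintro rfl; simp at hkpos)
  have h2 : 2 ^ (r + 2) ≤ 8 := le_trans (Nat.le_mul_of_pos_right _ (Nat.mul_pos hn₁ hn₂)) hk8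
  refine ⟨?_, fun hr => ?_⟩
  · by_contra hr
    have h16 : 2 ^ 4 ≤ 2 ^ (r + 2) := Nat.pow_le_pow_right (by norm_num) (by omega)
    omega
  · subst hr
    norm_num at hk8
    constructor <;> nlinarith

/-- **The descent count, symmetric form** (Silverman X.4.2(a) for `φ` and `φ̂`; tree
`two_pow_twoIsogenySelmerRank_add_eq`): if `#S(a,b) · #S'(a,b) ≤ 8` then `rank E_{a,b}(ℚ) ≤ 1`, and if the
rank is `1` both `φ`-parts of `Ш` vanish. [cite: SilvermanAEC2009, Thm. X.4.2(a) and Prop. X.4.9] -/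
theorem rank_le_one_and_sha_parts_of_card_mul_le {a b : ℤ} (hab : b * (a ^ 2 - 4 * b) ≠ 0)
    [hV₀ : (⟨0, -(a : ℚ) / 2, 0, ((a : ℚ) ^ 2 - 4 * b) / 16, 0⟩ : WeierstrassCurve ℚ).IsElliptic]
    [hE : (⟨0, (a : ℚ), 0, (b : ℚ), 0⟩ : WeierstrassCurve ℚ).IsElliptic]
    (hSS : (twoIsogenySelmerGroup a b).card * (twoIsogenySelmerGroup' a b).card ≤ 8) :
    (⟨0, (a : ℚ), 0, (b : ℚ), 0⟩ : WeierstrassCurve ℚ).mordellWeilRank ≤ 1 ∧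
      ((⟨0, (a : ℚ), 0, (b : ℚ), 0⟩ : WeierstrassCurve ℚ).mordellWeilRank = 1 →
        (⟨0, -(a : ℚ) / 2, 0, ((a : ℚ) ^ 2 - 4 * b) / 16, 0⟩ : WeierstrassCurve ℚ).sha ⊓
            (⟨0, -(a : ℚ) / 2, 0, ((a : ℚ) ^ 2 - 4 * b) / 16, 0⟩ :
              WeierstrassCurve ℚ).twoIsogenyTorsorHom.range = ⊥ ∧
          (⟨0, (a : ℚ), 0, (b : ℚ), 0⟩ : WeierstrassCurve ℚ).sha ⊓
            (⟨0, (a : ℚ), 0, (b : ℚ), 0⟩ : WeierstrassCurve ℚ).twoIsogenyTorsorHom.range = ⊥) := by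
  have key := two_pow_twoIsogenySelmerRank_add_eq hab
  have h8 : 2 ^ (twoIsogenySelmerRank a b + twoIsogenySelmerRank' a b) ≤ 8 := by
    rw [pow_add, two_pow_twoIsogenySelmerRank_eq_card hab, two_pow_twoIsogenySelmerRank'_eq_card hab]
    exact hSS
  obtain ⟨hr, hparts⟩ := rank_le_one_arith' key h8 (by positivity)
  exact ⟨hr, fun h => by
    obtain ⟨h₁, h₂⟩ := hparts h
    exact ⟨AddSubgroup.eq_bot_of_card_eq _ h₁, AddSubgroup.eq_bot_of_card_eq _ h₂⟩⟩

/-- "`Ш` has no `2`-torsion" passes from `C • W` to `W` and along equalities of curves, and `Ш[2^∞] = 0`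
with `rank = r_an` turns Miller's `BSD(W,2)` into a `2`-adic unit statement — the bookkeeping shared by
the two families (tree: `galH1Equiv`/`sha_inf_torsionBy_eq_bot_smul`, `bsdp_iff`).
[cite: SilvermanAEC2009, X.§4] [cite: Miller2011LMS, Def. 1.1] -/
theorem bsdp_two_iff_shaAn_unit_of_forall_mem_sha (W : WeierstrassCurve ℚ)
    (h2 : ∀ c ∈ W.sha, 2 • c = 0 → c = 0) (hrank : W.mordellWeilRank = W.analyticRank) :
    AddCommGroup.primaryComponent W.sha 2 = ⊥ ∧
      (BSDp W 2 ↔ ∃ q : ℚ, shaAn W = (q : ℂ) ∧ padicValRat 2 q = 0) := by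
  have hbot := W.primaryComponent_sha_eq_bot_of_forall h2
  have hfin : Finite (AddCommGroup.primaryComponent W.sha 2) := by rw [hbot]; infer_instance
  have hcard : Nat.card (AddCommGroup.primaryComponent W.sha 2) = 1 := by
    rw [hbot]; exact AddSubgroup.card_bot
  refine ⟨hbot, ?_⟩
  rw [bsdp_iff]
  simp only [hrank, hfin, hcard, padicValNat_one_right, Nat.cast_zero, true_and]

/-- Transport of the complete descent from the two-torsion model `E = C' • W` to `W`: `rank W ≤ 1`, and
`rank W = 1 ⇒ Ш(W)[2] = 0`. [cite: SilvermanAEC2009, X.§4 and III.3.1(b)] -/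
theorem rank_le_one_and_sha_two_of_smul_eq (W E : WeierstrassCurve ℚ) [W.IsElliptic] [E.IsElliptic]
    (C' : VariableChange ℚ) (hE : C' • W = E)
    (hdesc : E.mordellWeilRank ≤ 1 ∧ (E.mordellWeilRank = 1 → ∀ c ∈ E.sha, 2 • c = 0 → c = 0)) :
    W.mordellWeilRank ≤ 1 ∧ (W.mordellWeilRank = 1 → ∀ c ∈ W.sha, 2 • c = 0 → c = 0) := by
  subst hE
  have hrk : (C' • W).mordellWeilRank = W.mordellWeilRank := by
    have h := mordellWeilRank_variableChange_holds W C'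
    unfold mordellWeilRank_variableChange at h
    convert h using 2
  refine ⟨hrk ▸ hdesc.1, fun hr => ?_⟩
  have h2 := hdesc.2 (hrk.trans hr)
  -- `Ш ⊓ H¹[2] = ⊥` for `C' • W`, then for `C'⁻¹ • (C' • W) = W`
  have h3 : ((C' • W).sha ⊓ AddSubgroup.torsionBy (C' • W).galH1 2 : AddSubgroup _) = ⊥ := by
    refine eq_bot_iff.mpr fun c hc ↦ ?_
    rw [AddSubgroup.mem_inf] at hc
    exact AddSubgroup.mem_bot.mpr (h2 _ hc.1 ((AddSubgroup.torsionBy.nsmul_iff (n := 2)).mp hc.2))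
  have h4 := sha_inf_torsionBy_eq_bot_smul (C' • W) C'⁻¹ 2 h3
  have transfer : ∀ {X Y : WeierstrassCurve ℚ} (_ : X = Y),
      (Y.sha ⊓ AddSubgroup.torsionBy Y.galH1 2 : AddSubgroup _) = ⊥ →
      ∀ c ∈ X.sha, 2 • c = 0 → c = 0 := by
    intro X Y h hY c hc hn
    subst h
    have : c ∈ (X.sha ⊓ AddSubgroup.torsionBy X.galH1 2 : AddSubgroup _) :=
      AddSubgroup.mem_inf.mpr ⟨hc, (AddSubgroup.torsionBy.nsmul_iff (n := 2)).mpr hn⟩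
    rw [hY] at this
    exact AddSubgroup.mem_bot.mp this
  exact transfer (inv_smul_smul C' W).symm h4

/-- **Two-torsion model of a twist of `49a1`.** For `C • W = cm7.quadraticTwist d` (`d ∈ ℤ`):
`(C₀ * C) • W = E_d = ⟨0, 21d, 0, 112d², 0⟩` with `C₀ = ⟨(mk0 2)⁻¹, 2d, 0, 0⟩` (the rational `2`-torsion
point `x = 2d` of `cm7^{(d)} : y² = x³ − (3d/4)x² − 2d²x − d³` is moved to the origin, the model scaled by
`u = 1/2`). [cite: SilvermanAEC2009, III.1 and X.5 Cor. 5.4] -/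
theorem smul_eq_twoTorsionModel_of_smul_eq_quadraticTwist (d : ℤ) (W : WeierstrassCurve ℚ)
    (C : VariableChange ℚ) (hC : C • W = cm7.quadraticTwist (d : ℚ)) :
    ((⟨(Units.mk0 (2 : ℚ) two_ne_zero)⁻¹, 2 * (d : ℚ), 0, 0⟩ : VariableChange ℚ) * C) • W =
      ⟨0, ((21 * d : ℤ) : ℚ), 0, ((112 * d ^ 2 : ℤ) : ℚ), 0⟩ := by
  rw [mul_smul, hC]
  ext
  · simp [variableChange_a₁]
  · simp only [variableChange_a₂, quadraticTwist_a₁, quadraticTwist_a₂, inv_inv, Units.val_mk0, b₂]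
    push_cast; norm_num; ring
  · simp [variableChange_a₃]
  · simp only [variableChange_a₄, quadraticTwist_a₁, quadraticTwist_a₂, quadraticTwist_a₃,
      quadraticTwist_a₄, inv_inv, Units.val_mk0, b₂, b₄]
    push_cast; norm_num; ring
  · simp only [variableChange_a₆, quadraticTwist_a₁, quadraticTwist_a₂, quadraticTwist_a₃,
      quadraticTwist_a₄, quadraticTwist_a₆, inv_inv, Units.val_mk0, b₂, b₄, b₆]
    norm_num; ring

/-! ## §2. The family `49a1^{(−m)}` -/

/-- `b (a² − 4b) ≠ 0` for `E_{−m}` (`m ≥ 1`). [folklore] -/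
theorem hab_inertTwist {m : ℕ} (hm0 : 0 < m) :
    (112 * m ^ 2 : ℤ) * ((-21 * m) ^ 2 - 4 * (112 * m ^ 2)) ≠ 0 := by
  have hm0' : (m : ℤ) ≠ 0 := by exact_mod_cast hm0.ne'
  rw [show ((-21 * m : ℤ) ^ 2 - 4 * (112 * m ^ 2)) = -7 * m ^ 2 by ring]
  exact mul_ne_zero (by positivity) (mul_ne_zero (by norm_num) (pow_ne_zero 2 hm0'))

/-- **`rank E_{−m}(ℚ) ≤ 1`, and `rank = 1 ⇒ Ш(E_{−m}/ℚ)[2] = 0`** (UNCONDITIONAL), for squarefree `m ≥ 1`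
with all prime factors `≡ 1 (mod 4)` and inert in `ℚ(√−7)`. [cite: SilvermanAEC2009, Thm. X.4.2(a), Prop. X.4.9] -/
theorem rank_le_one_and_sha_two_twoTorsionModel_inertTwist {m : ℕ} (hm0 : 0 < m) (hmsq : Squarefree m)
    (hinert : ∀ l : ℕ, l.Prime → l ∣ m → l % 4 = 1 ∧ ¬ IsSquare ((-7 : ℤ) : ZMod l))
    [hE : (⟨0, ((-21 * m : ℤ) : ℚ), 0, ((112 * m ^ 2 : ℤ) : ℚ), 0⟩ : WeierstrassCurve ℚ).IsElliptic] :
    (⟨0, ((-21 * m : ℤ) : ℚ), 0, ((112 * m ^ 2 : ℤ) : ℚ), 0⟩ : WeierstrassCurve ℚ).mordellWeilRank ≤ 1 ∧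
      ((⟨0, ((-21 * m : ℤ) : ℚ), 0, ((112 * m ^ 2 : ℤ) : ℚ), 0⟩ : WeierstrassCurve ℚ).mordellWeilRank = 1 →
        ∀ c ∈ (⟨0, ((-21 * m : ℤ) : ℚ), 0, ((112 * m ^ 2 : ℤ) : ℚ), 0⟩ : WeierstrassCurve ℚ).sha,
          2 • c = 0 → c = 0) := by
  have hab := hab_inertTwist hm0
  haveI := isElliptic_halfModel hab
  have hS : (twoIsogenySelmerGroup (-21 * m) (112 * m ^ 2)).card ≤ 4 :=
    le_trans (Finset.card_le_card fun d hd =>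
      mem_of_mem_twoIsogenySelmerGroup_inertTwist hm0 hmsq (fun l hl hlm => (hinert l hl hlm).2) hd)
      Finset.card_le_four
  have hS' : (twoIsogenySelmerGroup' (-21 * m) (112 * m ^ 2)).card ≤ 2 :=
    le_trans (Finset.card_le_card fun d hd =>
      mem_of_mem_twoIsogenySelmerGroup'_inertTwist hm0 hmsq hinert hd) Finset.card_le_two
  obtain ⟨hr, hparts⟩ := rank_le_one_and_sha_parts_of_card_mul_le hab
    (by nlinarith [hS, hS', Nat.zero_le (twoIsogenySelmerGroup (-21 * m) (112 * m ^ 2)).card])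
  refine ⟨hr, fun h => ?_⟩
  obtain ⟨h₀, h₁⟩ := hparts h
  exact forall_mem_sha_two_smul_eq_zero_of_halfModel h₀ h₁

/-- **UNCONDITIONAL: `rank W(ℚ) ≤ 1`, and `rank W(ℚ) = 1 ⇒ Ш(W/ℚ)[2] = 0`, for every model `W` of
`49a1^{(−m)}`**, `m ≥ 1` squarefree with all prime factors `≡ 1 (mod 4)` and inert in `ℚ(√−7)`.
[cite: SilvermanAEC2009, Thm. X.4.2(a), Prop. X.4.9, Thm. III.6.2(a)] -/
theorem rank_le_one_and_sha_two_inertTwist {m : ℕ} (hm0 : 0 < m) (hmsq : Squarefree m)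
    (hinert : ∀ l : ℕ, l.Prime → l ∣ m → l % 4 = 1 ∧ ¬ IsSquare ((-7 : ℤ) : ZMod l))
    (W : WeierstrassCurve ℚ) [W.IsElliptic] (C : VariableChange ℚ)
    (hC : C • W = cm7.quadraticTwist ((-m : ℤ) : ℚ)) :
    W.mordellWeilRank ≤ 1 ∧ (W.mordellWeilRank = 1 → ∀ c ∈ W.sha, 2 • c = 0 → c = 0) := by
  haveI := isElliptic_mk_of_ne_zero (F := ℚ) (hab_inertTwist hm0)
  have hE := (smul_eq_twoTorsionModel_of_smul_eq_quadraticTwist (-m) W C hC).trans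
    (show (⟨0, ((21 * (-m : ℤ) : ℤ) : ℚ), 0, ((112 * (-m : ℤ) ^ 2 : ℤ) : ℚ), 0⟩ : WeierstrassCurve ℚ) =
        ⟨0, ((-21 * m : ℤ) : ℚ), 0, ((112 * m ^ 2 : ℤ) : ℚ), 0⟩ by ext <;> push_cast <;> ring)
  exact rank_le_one_and_sha_two_of_smul_eq W _ _ hE
    (rank_le_one_and_sha_two_twoTorsionModel_inertTwist hm0 hmsq hinert)

/-- **Twin″ on `49a1^{(−m)}`**, `m ≥ 1` squarefree with all prime factors `≡ 1 (mod 4)` inert in `ℚ(√−7)`: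
for every model `W` of analytic rank `1`, granted GZK: `rank = 1`, `Ш(W)[2^∞] = 0`,
`corank_{ℤ₂} Sel_{2^∞}(W) = 1`, and `BSD(W,2) ⟺ ∃ q : ℚ, #Ш_an(W) = q ∧ ord₂ q = 0`.
[cite: SilvermanAEC2009, Thm. X.4.2(a), Prop. X.4.9] [cite: Miller2011LMS, Def. 1.1]
[cite: Greenberg1999LNM, §1 pp. 54–57] -/
theorem bsdp_two_iff_shaAn_unit_inertTwist (hGZK : rank_eq_analyticRank_of_analyticRank_le_one)
    {m : ℕ} (hm0 : 0 < m) (hmsq : Squarefree m)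
    (hinert : ∀ l : ℕ, l.Prime → l ∣ m → l % 4 = 1 ∧ ¬ IsSquare ((-7 : ℤ) : ZMod l))
    (W : WeierstrassCurve ℚ) [W.IsElliptic] (C : VariableChange ℚ)
    (hC : C • W = cm7.quadraticTwist ((-m : ℤ) : ℚ)) (har : W.analyticRank = 1) :
    W.mordellWeilRank = 1 ∧ AddCommGroup.primaryComponent W.sha 2 = ⊥ ∧ W.selmerCorank 2 = 1 ∧
      (BSDp W 2 ↔ ∃ q : ℚ, shaAn W = (q : ℂ) ∧ padicValRat 2 q = 0) := by
  haveI : Fact (Nat.Prime 2) := ⟨Nat.prime_two⟩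
  have hrank : W.mordellWeilRank = W.analyticRank := (hGZK W (by rw [har])).1
  have hr : W.mordellWeilRank = 1 := by rw [hrank, har]
  have h2 := (rank_le_one_and_sha_two_inertTwist hm0 hmsq hinert W C hC).2 hr
  obtain ⟨hbot, hiff⟩ := bsdp_two_iff_shaAn_unit_of_forall_mem_sha W h2 hrank
  refine ⟨hr, hbot, ?_, hiff⟩
  rw [W.selmerCorank_eq_mordellWeilRank_add_holds 2, hr, W.shaCorank_eq_zero_of_forall 2 h2]

/-! ## §3. The family `49a1^{(−2m)}` -/

/-- `b (a² − 4b) ≠ 0` for `E_{−2m}` (`m ≥ 1`). [folklore] -/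
theorem hab_inertTwoTwist {m : ℕ} (hm0 : 0 < m) :
    (448 * m ^ 2 : ℤ) * ((-42 * m) ^ 2 - 4 * (448 * m ^ 2)) ≠ 0 := by
  have hm0' : (m : ℤ) ≠ 0 := by exact_mod_cast hm0.ne'
  rw [show ((-42 * m : ℤ) ^ 2 - 4 * (448 * m ^ 2)) = -28 * m ^ 2 by ring]
  exact mul_ne_zero (by positivity) (mul_ne_zero (by norm_num) (pow_ne_zero 2 hm0'))

/-- **`rank E_{−2m}(ℚ) ≤ 1`, and `rank = 1 ⇒ Ш(E_{−2m}/ℚ)[2] = 0`** (UNCONDITIONAL), same `m`.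
[cite: SilvermanAEC2009, Thm. X.4.2(a), Prop. X.4.9] -/
theorem rank_le_one_and_sha_two_twoTorsionModel_inertTwoTwist {m : ℕ} (hm0 : 0 < m)
    (hmsq : Squarefree m)
    (hinert : ∀ l : ℕ, l.Prime → l ∣ m → l % 4 = 1 ∧ ¬ IsSquare ((-7 : ℤ) : ZMod l))
    [hE : (⟨0, ((-42 * m : ℤ) : ℚ), 0, ((448 * m ^ 2 : ℤ) : ℚ), 0⟩ : WeierstrassCurve ℚ).IsElliptic] :
    (⟨0, ((-42 * m : ℤ) : ℚ), 0, ((448 * m ^ 2 : ℤ) : ℚ), 0⟩ : WeierstrassCurve ℚ).mordellWeilRank ≤ 1 ∧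
      ((⟨0, ((-42 * m : ℤ) : ℚ), 0, ((448 * m ^ 2 : ℤ) : ℚ), 0⟩ : WeierstrassCurve ℚ).mordellWeilRank = 1 →
        ∀ c ∈ (⟨0, ((-42 * m : ℤ) : ℚ), 0, ((448 * m ^ 2 : ℤ) : ℚ), 0⟩ : WeierstrassCurve ℚ).sha,
          2 • c = 0 → c = 0) := by
  have hab := hab_inertTwoTwist hm0
  haveI := isElliptic_halfModel hab
  have hS : (twoIsogenySelmerGroup (-42 * m) (448 * m ^ 2)).card ≤ 4 :=
    le_trans (Finset.card_le_card fun d hd =>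
      mem_of_mem_twoIsogenySelmerGroup_inertTwoTwist hm0 hmsq hinert hd) Finset.card_le_four
  have hS' : (twoIsogenySelmerGroup' (-42 * m) (448 * m ^ 2)).card ≤ 2 :=
    le_trans (Finset.card_le_card fun d hd =>
      mem_of_mem_twoIsogenySelmerGroup'_inertTwoTwist hm0 hmsq hinert hd) Finset.card_le_two
  obtain ⟨hr, hparts⟩ := rank_le_one_and_sha_parts_of_card_mul_le hab
    (by nlinarith [hS, hS', Nat.zero_le (twoIsogenySelmerGroup (-42 * m) (448 * m ^ 2)).card])
  refine ⟨hr, fun h => ?_⟩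
  obtain ⟨h₀, h₁⟩ := hparts h
  exact forall_mem_sha_two_smul_eq_zero_of_halfModel h₀ h₁

/-- **UNCONDITIONAL: `rank W(ℚ) ≤ 1`, and `rank W(ℚ) = 1 ⇒ Ш(W/ℚ)[2] = 0`, for every model `W` of
`49a1^{(−2m)}`** (same `m`). [cite: SilvermanAEC2009, Thm. X.4.2(a), Prop. X.4.9, Thm. III.6.2(a)] -/
theorem rank_le_one_and_sha_two_inertTwoTwist {m : ℕ} (hm0 : 0 < m) (hmsq : Squarefree m)
    (hinert : ∀ l : ℕ, l.Prime → l ∣ m → l % 4 = 1 ∧ ¬ IsSquare ((-7 : ℤ) : ZMod l))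
    (W : WeierstrassCurve ℚ) [W.IsElliptic] (C : VariableChange ℚ)
    (hC : C • W = cm7.quadraticTwist ((-2 * m : ℤ) : ℚ)) :
    W.mordellWeilRank ≤ 1 ∧ (W.mordellWeilRank = 1 → ∀ c ∈ W.sha, 2 • c = 0 → c = 0) := by
  haveI := isElliptic_mk_of_ne_zero (F := ℚ) (hab_inertTwoTwist hm0)
  have hE := (smul_eq_twoTorsionModel_of_smul_eq_quadraticTwist (-2 * m) W C hC).trans
    (show (⟨0, ((21 * (-2 * m : ℤ) : ℤ) : ℚ), 0, ((112 * (-2 * m : ℤ) ^ 2 : ℤ) : ℚ), 0⟩ :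
        WeierstrassCurve ℚ) = ⟨0, ((-42 * m : ℤ) : ℚ), 0, ((448 * m ^ 2 : ℤ) : ℚ), 0⟩ by
      ext <;> push_cast <;> ring)
  exact rank_le_one_and_sha_two_of_smul_eq W _ _ hE
    (rank_le_one_and_sha_two_twoTorsionModel_inertTwoTwist hm0 hmsq hinert)

/-- **Twin″ on `49a1^{(−2m)}`** (same `m`): for every model `W` of analytic rank `1`, granted GZK:
`rank = 1`, `Ш(W)[2^∞] = 0`, `corank_{ℤ₂} Sel_{2^∞}(W) = 1`, and
`BSD(W,2) ⟺ ∃ q : ℚ, #Ш_an(W) = q ∧ ord₂ q = 0`. [cite: SilvermanAEC2009, Thm. X.4.2(a), Prop. X.4.9]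
[cite: Miller2011LMS, Def. 1.1] [cite: Greenberg1999LNM, §1 pp. 54–57] -/
theorem bsdp_two_iff_shaAn_unit_inertTwoTwist (hGZK : rank_eq_analyticRank_of_analyticRank_le_one)
    {m : ℕ} (hm0 : 0 < m) (hmsq : Squarefree m)
    (hinert : ∀ l : ℕ, l.Prime → l ∣ m → l % 4 = 1 ∧ ¬ IsSquare ((-7 : ℤ) : ZMod l))
    (W : WeierstrassCurve ℚ) [W.IsElliptic] (C : VariableChange ℚ)
    (hC : C • W = cm7.quadraticTwist ((-2 * m : ℤ) : ℚ)) (har : W.analyticRank = 1) :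
    W.mordellWeilRank = 1 ∧ AddCommGroup.primaryComponent W.sha 2 = ⊥ ∧ W.selmerCorank 2 = 1 ∧
      (BSDp W 2 ↔ ∃ q : ℚ, shaAn W = (q : ℂ) ∧ padicValRat 2 q = 0) := by
  haveI : Fact (Nat.Prime 2) := ⟨Nat.prime_two⟩
  have hrank : W.mordellWeilRank = W.analyticRank := (hGZK W (by rw [har])).1
  have hr : W.mordellWeilRank = 1 := by rw [hrank, har]
  have h2 := (rank_le_one_and_sha_two_inertTwoTwist hm0 hmsq hinert W C hC).2 hr
  obtain ⟨hbot, hiff⟩ := bsdp_two_iff_shaAn_unit_of_forall_mem_sha W h2 hrank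
  refine ⟨hr, hbot, ?_, hiff⟩
  rw [W.selmerCorank_eq_mordellWeilRank_add_holds 2, hr, W.shaCorank_eq_zero_of_forall 2 h2]

end Summit.BirchSwinnertonDyer.BirchSwinnertonDyer.Theorems.GoldfeldGoodTwists

end
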